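import Mathlib
import Literature.Algebra.EuclideanLattices.QaryLatticeDuality
import HarnessLib

/-!
# `MagicFunctionsPersist`, line `Sketch`: stub `stub_halfPointDepth` (item stmt-PneNP-2328)

Depth of the canonical half-lattice point of `Λ_q(Aᵀ) = rowLattice A ⊆ ℤⁿ ⊆ ℝⁿ` (embedded by
`intToEuc (Fin n)`): for odd `q`, if every nonzero vector of `Λ_q(Aᵀ)` has Euclidean norm `≥ r`,
then `t = (q/2) e_{i₀}` is at distance `≥ r/2` from `Λ_q(Aᵀ)`. Indeed for `y ∈ Λ_q(Aᵀ)` one has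
`2 (t − y) = q e_{i₀} − 2y ∈ Λ_q(Aᵀ)` (as `qℤⁿ ⊆ Λ_q(Aᵀ)`), and its `i₀`-th coordinate
`q − 2 y_{i₀}` is odd, hence the vector is nonzero and has norm `≥ r`.
-/

set_option linter.dupNamespace false

noncomputable section

open Literature.Algebra.EuclideanLattices

namespace Summit.PneNP.PneNP.Theorems.LatticeMagicMagicFunctionsPersist

/-- **Depth of the canonical half point.** For odd `q`, if every nonzero vector of `Λ_q(Aᵀ)` has
norm `≥ r`, then the half point `t = (q/2) e_{i₀}` is at distance `≥ r/2` from `Λ_q(Aᵀ) ⊆ ℝⁿ`: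
for `y ∈ Λ_q(Aᵀ)`, `2‖t − y‖ = ‖q e_{i₀} − 2y‖` and `q e_{i₀} − 2y` is a vector of `Λ_q(Aᵀ)` with odd
(hence nonzero) `i₀`-th coordinate. -/
theorem stub_halfPointDepth {n k q : ℕ} (hq : Odd q) (A : Matrix (Fin k) (Fin n) (ZMod q))
    (i₀ : Fin n) {r : ℝ} (hmin : ∀ y ∈ rowLattice A, y ≠ 0 → r ≤ ‖intToEuc (Fin n) y‖) :
    r / 2 ≤ Metric.infDist ((1 / 2 : ℝ) • intToEuc (Fin n) ((q : ℤ) • Pi.single i₀ 1))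
      (((rowLattice A).map (intToEuc (Fin n)) : Submodule ℤ (EuclideanSpace ℝ (Fin n))) :
        Set (EuclideanSpace ℝ (Fin n))) := by
  have hne : (((rowLattice A).map (intToEuc (Fin n)) : Submodule ℤ (EuclideanSpace ℝ (Fin n))) :
      Set (EuclideanSpace ℝ (Fin n))).Nonempty := ⟨0, Submodule.zero_mem _⟩
  rw [Metric.le_infDist hne]
  intro x hx
  rw [SetLike.mem_coe, Submodule.mem_map] at hx
  obtain ⟨y, hy, rfl⟩ := hx
  -- the lattice vector `u = q e_{i₀} - 2y = 2 (t - y)`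
  set u : Fin n → ℤ := (q : ℤ) • Pi.single i₀ 1 - (2 : ℤ) • y with hu
  have humem : u ∈ rowLattice A :=
    sub_mem (qsmul_mem_rowLattice A _) (Submodule.smul_mem _ _ hy)
  have hodd : Odd (u i₀) := by
    have hui : u i₀ = (q : ℤ) - 2 * y i₀ := by simp [hu]
    rw [hui]
    exact hq.natCast.sub_even (even_two_mul _)
  have hu0 : u ≠ 0 := by
    intro h
    rw [h, Pi.zero_apply] at hodd
    exact Int.not_odd_zero hodd
  have hdiff : (1 / 2 : ℝ) • intToEuc (Fin n) ((q : ℤ) • Pi.single i₀ 1) - intToEuc (Fin n) y =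
      (1 / 2 : ℝ) • intToEuc (Fin n) u := by
    ext j
    simp only [hu, PiLp.sub_apply, PiLp.smul_apply, intToEuc_apply, Pi.sub_apply, Pi.smul_apply,
      smul_eq_mul, Int.cast_sub, Int.cast_mul, Int.cast_ofNat, Int.cast_natCast]
    ring
  rw [dist_eq_norm, hdiff, norm_smul, Real.norm_of_nonneg (by norm_num : (0 : ℝ) ≤ 1 / 2)]
  have hr := hmin u humem hu0
  linarith

end Summit.PneNP.PneNP.Theorems.LatticeMagicMagicFunctionsPersist
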